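import Literature.NumberTheory.GaloisRepresentations.UnramifiedPeriodMatrix
import Literature.NumberTheory.GaloisRepresentations.UnramifiedPeriodRing
import Literature.NumberTheory.GaloisRepresentations.StableLatticeValuationRing
import Literature.NumberTheory.GaloisRepresentations.PAdicHodgeProofs
import Literature.NumberTheory.GaloisRepresentations.PstWeilDeligne
import Literature.NumberTheory.Automorphic.ReciprocityGLnQlModelProofs
import Literature.NumberTheory.GaloisRepresentations.AbsGaloisGroupCompact
import Mathlib.Topology.Algebra.Module.FiniteDimension
import Mathlib.LinearAlgebra.Matrix.ToLinearEquiv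
import Mathlib.RingTheory.TensorProduct.Free
import HarnessLib

/-!
# Unramified `p`-adic representations are `B`-admissible for every period ring containing `𝒪̂_{F_nr}`

Let `F` be a non-archimedean local field with a `ℚ_p`-algebra structure, `Γ_F = Gal(F̄/F)`,
`I_F` its inertia group, and `𝔅` a period-ring datum (Fontaine regular `(ℚ_p, Γ_F)`-ring with
invariants `F`, accepted `PeriodRingData`) together with a `Γ_F`-equivariant ring map
`ι : 𝒪̂_{F_nr} → B` compatible with the structure maps (`𝒪_F → 𝒪̂_{F_nr} → B` equals
`𝒪_F → F → B`).  Main results: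

* `PeriodRingData.isAdmissible_of_unramified` — **every continuous `ℚ_p`-linear representation
  `ρ` of `Γ_F` on a finite-dimensional Hausdorff topological vector space which is unramified
  (`ρ(σ) = 1` for `σ ∈ I_F`) is `𝔅`-admissible**: `dim_F (B ⊗_{ℚ_p} V)^{Γ_F} = dim_{ℚ_p} V`
  (Fontaine 1994, Exp. III, §1.5 with Prop. 1.6.2 / Fontaine–Ouyang Prop. 2.14, Thm. 2.13:
  unramified representations are `K̂^nr`-admissible, a fortiori `B`-admissible for `B ⊇ K̂^nr`).
  Proof: a `Γ_F`-stable `ℤ_p`-lattice (accepted `exists_integralModel_of_valuationSubring`,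
  compactness of `Γ_F`) gives an integral frame `r : Γ_F →ₜ* GL_N(ℤ_p)`; the period matrix
  `X ∈ GL_N(𝒪̂_{F_nr})`, `X = r(σ) σ(X)` (`exists_isUnit_forall_eq_mul_galAut`, Lang's theorem),
  pushed into `B` gives `N` invariant vectors `∑ᵢ ι(X_{ij}) ⊗ bᵢ`, linearly independent over `B`
  hence over `F`; Fontaine's inequality (accepted `linearIndependent_of_mem_D`) gives `≤`.
* `isAdmissible_unramifiedPeriodRingData_of_unramified` — the case `B = F̂_nr`
  (`unramifiedPeriodRingData`).
* `FramedRep.isDeRhamWith_unramifiedPeriodRingData_of_isLocallyUnramified` — the framed,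
  `ℚ̄_p`-valued form used by `PstWeilDeligneData`: an unramified `ρ : Γ_F →ₜ* GL_n(ℚ̄_p)` is
  `F̂_nr`-de Rham (`FramedRep.IsDeRhamWith`), through its model over a finite `E/ℚ_p`
  (accepted `exists_hasQlModel_holds`).

Auxiliary: `padicValuationSubring p` (`ℤ_p ⊆ ℚ_p` as a valuation subring) and
`ContinuousRep.exists_basis_integralFrame` (integral frames of compact-group representations over
`ℚ_p`).  No named facts.

## References

* J.-M. Fontaine, *Représentations p-adiques semi-stables*, Astérisque 223 (1994), Exp. III §1.5–1.6.
  [FontaineAsterisque223III]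
* J.-M. Fontaine, Y. Ouyang, *Theory of p-adic Galois representations*, Prop. 2.14, Thm. 2.13.
* J.-P. Serre, *Local Fields*, GTM 67, Ch. XIII §5; *Abelian ℓ-adic representations*, I.1.1.
  [SerreLocalFields1979] [SerreAbelianLadic1968]
-/

noncomputable section

open ValuativeRel Field IsLocalRing Matrix TensorProduct
open scoped MatrixGroups TensorProduct

namespace Literature.NumberTheory.GaloisRepresentations

universe u w w'

/-! ### `ℤ_p ⊆ ℚ_p` as a valuation subring -/

section Padic

variable (p : ℕ) [Fact p.Prime]

/-- `ℤ_p ⊆ ℚ_p` as a valuation subring of `ℚ_p` (Mathlib's `PadicInt.subring` with `x ∈ O ∨ x⁻¹ ∈ O`).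
[folklore] -/
def padicValuationSubring : ValuationSubring ℚ_[p] :=
  { PadicInt.subring p with
    mem_or_inv_mem' := fun x => by
      change ‖x‖ ≤ 1 ∨ ‖x⁻¹‖ ≤ 1
      rcases le_or_gt ‖x‖ 1 with h | h
      · exact Or.inl h
      · exact Or.inr (by rw [norm_inv]; exact inv_le_one_of_one_le₀ h.le) }

variable {p}

/-- Membership in `padicValuationSubring`: norm at most one. [folklore] -/
@[simp] theorem mem_padicValuationSubring_iff {x : ℚ_[p]} : x ∈ padicValuationSubring p ↔ ‖x‖ ≤ 1 :=
  Iff.rfl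

variable (p) in
/-- `ℤ_p` is open in `ℚ_p`. [folklore] -/
theorem isOpen_padicValuationSubring : IsOpen (padicValuationSubring p : Set ℚ_[p]) := by
  have : (padicValuationSubring p : Set ℚ_[p]) = Metric.closedBall 0 1 := by
    ext x
    rw [SetLike.mem_coe, mem_padicValuationSubring_iff, Metric.mem_closedBall, dist_zero_right]
  rw [this]
  exact IsUltrametricDist.isOpen_closedBall _ one_ne_zero

variable (p) in
/-- The tautological identification of `padicValuationSubring p` with `ℤ_[p]`. [folklore] -/
def padicValuationSubringEquiv : padicValuationSubring p ≃+* ℤ_[p] where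
  toFun x := ⟨x.1, x.2⟩
  invFun z := ⟨z.1, z.2⟩
  left_inv _ := rfl
  right_inv _ := rfl
  map_mul' _ _ := rfl
  map_add' _ _ := rfl

/-- Unfolding lemma for `padicValuationSubringEquiv`. [folklore] -/
@[simp] theorem coe_padicValuationSubringEquiv (x : padicValuationSubring p) :
    ((padicValuationSubringEquiv p x : ℤ_[p]) : ℚ_[p]) = (x : ℚ_[p]) := rfl

end Padic

/-! ### Integral frames of compact-group representations over `ℚ_p` -/

section IntegralFrame

variable {p : ℕ} [Fact p.Prime] {Γ : Type*} [Group Γ] [TopologicalSpace Γ] [IsTopologicalGroup Γ]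
  [CompactSpace Γ] {V : Type*} [AddCommGroup V] [Module ℚ_[p] V] [TopologicalSpace V]
  [IsTopologicalAddGroup V] [ContinuousSMul ℚ_[p] V] [T2Space V] [FiniteDimensional ℚ_[p] V]

/-- **Integral frames** (Serre, *Abelian ℓ-adic representations*, I.1.1: a compact group stabilises
a lattice). A continuous representation of a compact group `Γ` on a finite-dimensional Hausdorff
topological `ℚ_p`-vector space `V` has a basis `b` in which it is given by a continuous
homomorphism `r : Γ →ₜ* GL_N(ℤ_p)`: `ρ(σ) bⱼ = ∑ᵢ r(σ)ᵢⱼ bᵢ`. [cite: SerreAbelianLadic1968, Ch. I §1.1] -/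
theorem ContinuousRep.exists_basis_integralFrame (ρ : ContinuousRep Γ ℚ_[p] V) :
    ∃ (b : Module.Basis (Fin (Module.finrank ℚ_[p] V)) ℚ_[p] V)
      (r : Γ →ₜ* GL (Fin (Module.finrank ℚ_[p] V)) ℤ_[p]),
      ∀ (σ : Γ) (j : Fin (Module.finrank ℚ_[p] V)),
        ρ σ (b j) = ∑ i, (((r σ : GL (Fin (Module.finrank ℚ_[p] V)) ℤ_[p]) :
          Matrix (Fin (Module.finrank ℚ_[p] V)) (Fin (Module.finrank ℚ_[p] V)) ℤ_[p]) i j : ℚ_[p]) • b i := by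
  classical
  haveI : IsModuleTopology ℚ_[p] V := isModuleTopologyOfFiniteDimensional
  set N := Module.finrank ℚ_[p] V
  let b₀ : Module.Basis (Fin N) ℚ_[p] V := Module.finBasis ℚ_[p] V
  let ρf : Γ →ₜ* GL (Fin N) ℚ_[p] := ρ.frame b₀
  obtain ⟨P, ρ₀, hρ₀⟩ :=
    exists_integralModel_of_valuationSubring (O := padicValuationSubring p) (isOpen_padicValuationSubring p) ρf
  -- the new basis `b = b₀ P`
  have hPdet : IsUnit (P : Matrix (Fin N) (Fin N) ℚ_[p]).det :=
    (Matrix.isUnit_iff_isUnit_det _).1 P.isUnit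
  let b : Module.Basis (Fin N) ℚ_[p] V := b₀.map (Matrix.toLinearEquiv b₀ (P : Matrix (Fin N) (Fin N) ℚ_[p]) hPdet)
  have hb : ∀ j, b j = Matrix.toLin b₀ b₀ (P : Matrix (Fin N) (Fin N) ℚ_[p]) (b₀ j) := fun j => by
    simp only [b, Module.Basis.map_apply, Matrix.toLinearEquiv_apply]
  -- the integral frame over `ℤ_p`
  let r₀ : Γ →* GL (Fin N) ℤ_[p] :=
    (Matrix.GeneralLinearGroup.map (padicValuationSubringEquiv p).toRingHom).comp ρ₀
  have hr₀ : ∀ σ, (PadicInt.Coe.ringHom (p := p)).mapMatrix ((r₀ σ : GL (Fin N) ℤ_[p]) : Matrix (Fin N) (Fin N) ℤ_[p]) =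
      ((P⁻¹ * ρf σ * P : GL (Fin N) ℚ_[p]) : Matrix (Fin N) (Fin N) ℚ_[p]) := by
    intro σ
    rw [← hρ₀ σ]
    rfl
  have hval : Continuous fun σ => ((r₀ σ : GL (Fin N) ℤ_[p]) : Matrix (Fin N) (Fin N) ℤ_[p]) := by
    refine continuous_matrix fun i j => ?_
    refine (PadicInt.isOpenEmbedding_coe (p := p)).isInducing.continuous_iff.2 ?_
    have hc : Continuous fun σ => (((P⁻¹ : GL (Fin N) ℚ_[p]) : Matrix (Fin N) (Fin N) ℚ_[p]) *
        ((ρf σ : GL (Fin N) ℚ_[p]) : Matrix (Fin N) (Fin N) ℚ_[p]) * (P : Matrix (Fin N) (Fin N) ℚ_[p])) i j :=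
      ((continuous_const.mul (Units.continuous_val.comp ρf.continuous_toFun)).mul continuous_const).matrix_elem i j
    refine hc.congr fun σ => ?_
    simp only [Function.comp_apply]
    rw [← Units.val_mul, ← Units.val_mul, ← hr₀ σ]
    rfl
  have hcont : Continuous r₀ := by
    refine Units.continuous_iff.2 ⟨hval, ?_⟩
    have h := hval.comp continuous_inv
    simp only [Function.comp_def, map_inv] at h
    exact h
  refine ⟨b, ⟨r₀, hcont⟩, fun σ j => ?_⟩
  -- the identity `ρ σ (b j) = ∑ i, r(σ)ᵢⱼ • bᵢ`
  set C : Matrix (Fin N) (Fin N) ℚ_[p] :=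
    (PadicInt.Coe.ringHom (p := p)).mapMatrix ((r₀ σ : GL (Fin N) ℤ_[p]) : Matrix (Fin N) (Fin N) ℤ_[p]) with hC
  have hPC : (P : Matrix (Fin N) (Fin N) ℚ_[p]) * C =
      LinearMap.toMatrix b₀ b₀ (ρ σ) * (P : Matrix (Fin N) (Fin N) ℚ_[p]) := by
    rw [hC, hr₀, ← Units.val_mul, ← mul_assoc, ← mul_assoc, mul_inv_cancel, one_mul, Units.val_mul]
    rfl
  change ρ σ (b j) = ∑ i, C i j • b i
  calc ρ σ (b j)
      = Matrix.toLin b₀ b₀ (LinearMap.toMatrix b₀ b₀ (ρ σ)) (Matrix.toLin b₀ b₀ (P : Matrix (Fin N) (Fin N) ℚ_[p]) (b₀ j)) := by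
        rw [Matrix.toLin_toMatrix, hb]
    _ = Matrix.toLin b₀ b₀ (LinearMap.toMatrix b₀ b₀ (ρ σ) * (P : Matrix (Fin N) (Fin N) ℚ_[p])) (b₀ j) := by
        rw [Matrix.toLin_mul b₀ b₀ b₀, LinearMap.comp_apply]
    _ = Matrix.toLin b₀ b₀ ((P : Matrix (Fin N) (Fin N) ℚ_[p]) * C) (b₀ j) := by rw [hPC]
    _ = Matrix.toLin b₀ b₀ (P : Matrix (Fin N) (Fin N) ℚ_[p]) (Matrix.toLin b₀ b₀ C (b₀ j)) := by
        rw [Matrix.toLin_mul b₀ b₀ b₀, LinearMap.comp_apply]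
    _ = Matrix.toLin b₀ b₀ (P : Matrix (Fin N) (Fin N) ℚ_[p]) (∑ i, C i j • b₀ i) := by rw [Matrix.toLin_self]
    _ = ∑ i, C i j • b i := by
        rw [map_sum]
        exact Finset.sum_congr rfl fun i _ => by rw [map_smul, hb]

end IntegralFrame

/-! ### Fontaine's inequality on ranks -/

section Rank

universe u₁ u₂ u₃ u₄ u₅

variable {Γ : Type u₁} [Group Γ] [TopologicalSpace Γ] {P : Type u₂} {E : Type u₃} [Field P]
  [TopologicalSpace P] [Field E] [Algebra P E]
  {M : Type u₅} [AddCommGroup M] [Module P M] [TopologicalSpace M]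

-- Mathlib's own global value of `maxSynthPendingDepth` (the project default `1` makes nested
-- instance problems on `𝔅.B ⊗[P] M` fail spuriously; see the note in `PAdicHodgeProofs`).
set_option maxSynthPendingDepth 3 in
/-- **Fontaine's inequality, rank form**: `rank_E D_B(V) ≤ dim_P V` (so in particular `D_B(V)` is
finite-dimensional); same proof as the accepted `PeriodRingData.finrank_D_le_holds`
(`linearIndependent_of_mem_D`). [cite: FontaineAsterisque223III, Prop. 1.4.2 and Thm. 1.5.2] -/
theorem PeriodRingData.rank_D_le (𝔅 : PeriodRingData.{u₁, u₂, u₃, u₄} Γ P E) (ρ : ContinuousRep Γ P M)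
    [FiniteDimensional P M] : Module.rank E (𝔅.D ρ) ≤ Module.finrank P M := by
  refine rank_le fun s hs => ?_
  have h1 : LinearIndependent E (fun i : s => ((i : 𝔅.D ρ) : 𝔅.B ⊗[P] M)) :=
    hs.map' (𝔅.D ρ).subtype (Submodule.ker_subtype _)
  have h2 : LinearIndependent 𝔅.B (fun i : s => ((i : 𝔅.D ρ) : 𝔅.B ⊗[P] M)) :=
    𝔅.linearIndependent_of_mem_D ρ (fun i => (i : 𝔅.D ρ).2) h1
  have h3 := h2.fintype_card_le_finrank
  rw [Fintype.card_coe] at h3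
  exact h3.trans_eq Module.finrank_baseChange

end Rank

/-! ### Admissibility of unramified representations -/

namespace IsNonarchimedeanLocalField

variable {F : Type u} [Field F] [ValuativeRel F] [TopologicalSpace F] [IsNonarchimedeanLocalField F]
  {p : ℕ} [Fact p.Prime] [Algebra ℚ_[p] F]

-- Mathlib's own global value of `maxSynthPendingDepth` (see `PeriodRingData.rank_D_le`).
set_option maxSynthPendingDepth 3 in
/-- **Unramified representations are `B`-admissible for every period ring `B` receiving `𝒪̂_{F_nr}`.**
Let `𝔅` be a period-ring datum for `Γ_F` over `ℚ_p` with invariants `F`, and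
`ι : 𝒪̂_{F_nr} → B` a `Γ_F`-equivariant ring map with `ι ∘ (𝒪_F → 𝒪̂_{F_nr}) =
(F → B) ∘ (𝒪_F → F)` (such `ι` is automatically injective).  Then every continuous representation `ρ` of `Γ_F` on a
finite-dimensional Hausdorff topological `ℚ_p`-vector space `V` with `ρ|_{I_F} = 1` satisfies
`dim_F (B ⊗_{ℚ_p} V)^{Γ_F} = dim_{ℚ_p} V` (Fontaine 1994, Exp. III §1.5 and Prop. 1.6.2 for
`B = K̂^nr ⊆ B`; Fontaine–Ouyang, Prop. 2.14: `H¹(Γ_F, GL_n(K̂^nr))` is trivial on unramified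
cocycles — Lang's theorem). [cite: FontaineAsterisque223III, Exp. III §1.5] -/
theorem PeriodRingData.isAdmissible_of_unramified
    (𝔅 : PeriodRingData.{u, 0, u, w} (absoluteGaloisGroup F) ℚ_[p] F)
    (ι : maxUnramifiedCompletion F →+* 𝔅.B)
    (hισ : ∀ (σ : absoluteGaloisGroup F) (x : maxUnramifiedCompletion F),
      σ • ι x = ι (maxUnramifiedCompletion.galAut F σ x))
    (hιa : ∀ a : 𝒪[F], ι (algebraMap 𝒪[F] (maxUnramifiedCompletion F) a) = algebraMap F 𝔅.B (a : F))
    {V : Type w'} [AddCommGroup V] [Module ℚ_[p] V] [TopologicalSpace V] [IsTopologicalAddGroup V]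
    [ContinuousSMul ℚ_[p] V] [T2Space V] [FiniteDimensional ℚ_[p] V]
    (ρ : ContinuousRep (absoluteGaloisGroup F) ℚ_[p] V)
    (hρ : ∀ σ ∈ absInertia F, ∀ v : V, ρ σ v = v) :
    𝔅.IsAdmissible ρ := by
  classical
  haveI : CompactSpace (absoluteGaloisGroup F) := absoluteGaloisGroup_compactSpace F
  set N := Module.finrank ℚ_[p] V with hN
  -- an integral frame
  obtain ⟨b, r, hbr⟩ := ρ.exists_basis_integralFrame
  -- `r` is unramified
  have hr : ∀ σ ∈ absInertia F, r σ = 1 := by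
    intro σ hσ
    refine Units.ext (Matrix.ext fun i j => PadicInt.ext ?_)
    have h1 := hbr σ j
    rw [hρ σ hσ] at h1
    have h2 := congrArg (fun v => b.repr v i) h1
    simp only [b.repr_sum_self, b.repr_self_apply] at h2
    rw [← h2, Units.val_one, Matrix.one_apply]
    by_cases hij : i = j
    · subst hij; simp
    · rw [if_neg (Ne.symm hij), if_neg hij, PadicInt.coe_zero]
  -- the period matrix over `𝒪̂_{F_nr}` and its image `Y` in `B`
  obtain ⟨X, hXu, hX⟩ := exists_isUnit_forall_eq_mul_galAut (p := p) r hr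
  have hιp : ∀ z : ℤ_[p], ι (padicIntToCompletion F p z) = algebraMap ℚ_[p] 𝔅.B (z : ℚ_[p]) := fun z => by
    rw [padicIntToCompletion, RingHom.comp_apply, hιa, coe_padicIntToInteger, PeriodRingData.algebraMap_eq]
  set Y : Matrix (Fin N) (Fin N) 𝔅.B := ι.mapMatrix X with hYdef
  have hYapply : ∀ i j, Y i j = ι (X i j) := fun i j => rfl
  have hY : ∀ (σ : absoluteGaloisGroup F) (k j : Fin N),
      Y k j = ∑ i, (((r σ : GL (Fin N) ℤ_[p]) : Matrix (Fin N) (Fin N) ℤ_[p]) k i : ℚ_[p]) • σ • Y i j := by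
    intro σ k j
    have h := congrArg (fun M : Matrix (Fin N) (Fin N) (maxUnramifiedCompletion F) => ι (M k j)) (hX σ)
    simp only [Matrix.mul_apply, map_sum, map_mul] at h
    rw [hYapply, h]
    refine Finset.sum_congr rfl fun i _ => ?_
    simp only [RingHom.mapMatrix_apply, Matrix.map_apply, RingEquiv.toRingHom_eq_coe, RingEquiv.coe_toRingHom]
    rw [hιp, ← hισ, hYapply, Algebra.smul_def]
  -- the invariant vectors
  let w : Fin N → 𝔅.B ⊗[ℚ_[p]] V := fun j => ∑ i, Y i j ⊗ₜ[ℚ_[p]] b i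
  have hwD : ∀ j, w j ∈ 𝔅.D ρ := by
    intro j
    rw [PeriodRingData.mem_D_iff]
    intro σ
    simp only [w, map_sum, PeriodRingData.tensorRep_apply_tmul]
    calc ∑ i, (σ • Y i j) ⊗ₜ[ℚ_[p]] ρ σ (b i)
        = ∑ i, ∑ k, ((((r σ : GL (Fin N) ℤ_[p]) : Matrix (Fin N) (Fin N) ℤ_[p]) k i : ℚ_[p]) • σ • Y i j) ⊗ₜ[ℚ_[p]] b k := by
          refine Finset.sum_congr rfl fun i _ => ?_
          rw [hbr σ i, TensorProduct.tmul_sum]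
          refine Finset.sum_congr rfl fun k _ => ?_
          exact (TensorProduct.smul_tmul _ _ _).symm
      _ = ∑ k, (∑ i, (((r σ : GL (Fin N) ℤ_[p]) : Matrix (Fin N) (Fin N) ℤ_[p]) k i : ℚ_[p]) • σ • Y i j) ⊗ₜ[ℚ_[p]] b k := by
          rw [Finset.sum_comm]
          refine Finset.sum_congr rfl fun k _ => ?_
          rw [TensorProduct.sum_tmul]
      _ = ∑ k, Y k j ⊗ₜ[ℚ_[p]] b k := Finset.sum_congr rfl fun k _ => by rw [← hY σ k j]
  -- they are linearly independent over `B`, hence over `F`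
  let β : Module.Basis (Fin N) 𝔅.B (𝔅.B ⊗[ℚ_[p]] V) := Algebra.TensorProduct.basis 𝔅.B b
  have hYdet : IsUnit Y.det := (Matrix.isUnit_iff_isUnit_det _).1 (hXu.map ι.mapMatrix)
  have hw : ∀ j, w j = Matrix.toLin β β Y (β j) := by
    intro j
    rw [Matrix.toLin_self]
    refine Finset.sum_congr rfl fun i _ => ?_
    rw [Algebra.TensorProduct.basis_apply, TensorProduct.smul_tmul', smul_eq_mul, mul_one]
  have hliB : LinearIndependent 𝔅.B w := by
    have h := β.linearIndependent.map' (Matrix.toLin β β Y) (Matrix.ker_toLin_eq_bot β Y hYdet)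
    rw [show w = ⇑(Matrix.toLin β β Y) ∘ ⇑β from funext hw]
    exact h
  have hliF : LinearIndependent F w := by
    refine hliB.restrict_scalars ?_
    intro x y hxy
    have h : algebraMap F 𝔅.B x = algebraMap F 𝔅.B y := by
      simpa only [Algebra.smul_def, mul_one] using hxy
    exact (algebraMap F 𝔅.B).injective h
  -- count dimensions
  have hliD : LinearIndependent F (fun j => (⟨w j, hwD j⟩ : 𝔅.D ρ)) :=
    LinearIndependent.of_comp (𝔅.D ρ).subtype (by exact hliF)
  have h1 : (N : Cardinal) ≤ Module.rank F (𝔅.D ρ) := by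
    simpa using hliD.cardinal_lift_le_rank
  have h2 : Module.rank F (𝔅.D ρ) ≤ N := 𝔅.rank_D_le ρ
  exact Module.finrank_eq_of_rank_eq (le_antisymm h2 h1)

variable (F p) in
/-- **Unramified representations are `F̂_nr`-admissible**: for the period-ring datum
`unramifiedPeriodRingData F p` (`B = F̂_nr`, the inertia invariants of `B_dR`), every continuous
`ℚ_p`-representation of `Γ_F` on a finite-dimensional Hausdorff space which is trivial on `I_F` is
admissible, `dim_F (F̂_nr ⊗ V)^{Γ_F} = dim V` (Fontaine 1994, Exp. III Prop. 1.6.2; Fontaine–Ouyang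
Prop. 2.14 / Thm. 2.13; Sen). [cite: FontaineAsterisque223III, Exp. III §1.5] -/
theorem isAdmissible_unramifiedPeriodRingData_of_unramified
    {V : Type w'} [AddCommGroup V] [Module ℚ_[p] V] [TopologicalSpace V] [IsTopologicalAddGroup V]
    [ContinuousSMul ℚ_[p] V] [T2Space V] [FiniteDimensional ℚ_[p] V]
    (ρ : ContinuousRep (absoluteGaloisGroup F) ℚ_[p] V)
    (hρ : ∀ σ ∈ absInertia F, ∀ v : V, ρ σ v = v) :
    (unramifiedPeriodRingData F p).IsAdmissible ρ :=
  PeriodRingData.isAdmissible_of_unramified (unramifiedPeriodRingData F p)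
    (algebraMap (maxUnramifiedCompletion F) (unramifiedPeriodField F))
    (fun σ x => unramifiedPeriodField.smul_algebraMap σ x)
    (fun a => (unramifiedPeriodField.algebraMap_coe_integer a).symm) ρ hρ

end IsNonarchimedeanLocalField

/-! ### The framed, `ℚ̄_p`-valued form -/

section Framed

open IsNonarchimedeanLocalField Literature.NumberTheory.Automorphic

variable {F : Type} [Field F] [ValuativeRel F] [TopologicalSpace F] [IsNonarchimedeanLocalField F]
  {p : ℕ} [Fact p.Prime]

/-- The scalar multiplication of `ℚ_p` on an intermediate field `ℚ_p ⊆ E ⊆ ℚ̄_p` is continuous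
(subspace topology). [folklore] -/
theorem IntermediateField.continuousSMul_padicAlgCl (E : IntermediateField ℚ_[p] (PadicAlgCl p)) :
    ContinuousSMul ℚ_[p] E :=
  ⟨Topology.IsInducing.subtypeVal.continuous_iff.2 (by
    have h : Continuous fun x : ℚ_[p] × E => x.1 • ((x.2 : E) : PadicAlgCl p) :=
      continuous_fst.smul (continuous_subtype_val.comp continuous_snd)
    exact h.congr fun x => rfl)⟩

/-- A model `rE` over `E ⊆ ℚ̄_p` of an unramified `ρ : Γ_F →ₜ* GL_n(ℚ̄_p)` is unramified, and so is
its underlying `ℚ_p`-linear representation. [folklore] -/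
theorem restrictScalarsQl_apply_eq_self_of_isLocallyUnramified {n : ℕ}
    {ρ : FramedRep (absoluteGaloisGroup F) (PadicAlgCl p) n} (hρ : ρ.IsLocallyUnramified)
    {E : IntermediateField ℚ_[p] (PadicAlgCl p)} {rE : FramedRep (absoluteGaloisGroup F) E n}
    (h : HasQlModel ρ E rE) (σ : absoluteGaloisGroup F) (hσ : σ ∈ absInertia F) (x : Fin n → E) :
    restrictScalarsQl E rE σ x = x := by
  obtain ⟨P, hP⟩ := h
  have h1 : FramedRep.conj P (rE.baseChange (algebraMap E (PadicAlgCl p)) continuous_subtype_val) σ = 1 := by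
    rw [hP]; exact hρ σ hσ
  rw [FramedRep.conj_apply, mul_inv_eq_one, mul_eq_left] at h1
  have h2 : rE σ = 1 := by
    refine Units.ext (Matrix.ext fun i j => Subtype.val_injective ?_)
    have h3 := congrArg (fun g : GL (Fin n) (PadicAlgCl p) => (g : Matrix (Fin n) (Fin n) (PadicAlgCl p)) i j) h1
    simp only [FramedRep.baseChange_apply, Units.val_one] at h3
    change algebraMap E (PadicAlgCl p) (((rE σ : GL (Fin n) E) : Matrix (Fin n) (Fin n) E) i j) =
      (1 : Matrix (Fin n) (Fin n) (PadicAlgCl p)) i j at h3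
    change algebraMap E (PadicAlgCl p) (((rE σ : GL (Fin n) E) : Matrix (Fin n) (Fin n) E) i j) =
      algebraMap E (PadicAlgCl p) (((1 : GL (Fin n) E) : Matrix (Fin n) (Fin n) E) i j)
    rw [h3, Units.val_one, Matrix.one_apply, Matrix.one_apply]
    split_ifs <;> simp
  rw [restrictScalarsQl_apply_apply, FramedRep.toContinuousRep_apply_apply, h2, Units.val_one, Matrix.one_mulVec]

/-- **Unramified `ρ : Γ_F →ₜ* GL_n(ℚ̄_p)` are `F̂_nr`-de Rham** (`FramedRep.IsDeRhamWith` for the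
datum `unramifiedPeriodRingData F p`): `ρ` has a model over a finite `E/ℚ_p` (accepted
`exists_hasQlModel_holds`), which is unramified, and its underlying `ℚ_p`-linear representation is
`F̂_nr`-admissible (`isAdmissible_unramifiedPeriodRingData_of_unramified`).  This is the field
`isDeRhamWith_of_isLocallyUnramified` of `PstWeilDeligneData` for the `F̂_nr`-datum (Fontaine 1994,
Exp. III Prop. 1.6.2; unramified ⇒ crystalline ⇒ de Rham). [cite: FontaineAsterisque223III, Exp. III §1.5] -/
theorem FramedRep.isDeRhamWith_unramifiedPeriodRingData_of_isLocallyUnramified [Algebra ℚ_[p] F] {n : ℕ}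
    (ρ : FramedRep (absoluteGaloisGroup F) (PadicAlgCl p) n) (hρ : ρ.IsLocallyUnramified) :
    ρ.IsDeRhamWith ‹Algebra ℚ_[p] F› (unramifiedPeriodRingData F p) := by
  obtain ⟨E, rE, hfin, hmodel⟩ := exists_hasQlModel_holds ρ
  haveI : FiniteDimensional ℚ_[p] E := hfin
  haveI : ContinuousSMul ℚ_[p] E := IntermediateField.continuousSMul_padicAlgCl E
  refine ⟨E, hfin, rE, hmodel, ?_⟩
  exact isAdmissible_unramifiedPeriodRingData_of_unramified F p (restrictScalarsQl E rE)
    (fun σ hσ x => restrictScalarsQl_apply_eq_self_of_isLocallyUnramified hρ hmodel σ hσ x)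

end Framed

end Literature.NumberTheory.GaloisRepresentations

end
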